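import Summits.HodgeConjecture.HodgeConjecture.Theorems.Ring2HypothesesDescentAlgebraicCorrespondencesSemisimple
import Summits.HodgeConjecture.HodgeConjecture.Theorems.Ring2AbelianAllLefschetzPencilsQuasiInverseHodge
import Summits.HodgeConjecture.HodgeConjecture.Theorems.Ring2AbelianAllAndreCorrespondenceCategory
import Literature.AlgebraicGeometry.HodgeTheory.MotivatedClassesAlgebraic
import Literature.AlgebraicGeometry.HodgeTheory.PolarizationClassExistence
import Literature.AlgebraicGeometry.Motives.AbelianVarietyExistence
import HarnessLib

/-!
# Ring 2 hypotheses, descent face — THE SUPPLY NODE (Q) `AlgebraicQuasiInverseOfLefschetzStandard` IS A THEOREM: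
# under `B(X)` every algebraic correspondence `u : Hᵃ(X(ℂ); ℂ) → Hᵇ(X(ℂ); ℂ)` has an ALGEBRAIC quasi-inverse `v`, `u v u = u`

research route conditional on HC_CM; not a corollary; Q11.4-sentence-2 already refuted in dim ≥ 3.
Cell `pub-hodge-ring2` (Hodge ladder STAGE 3), seat `ring2-b05` (binder row b05
`Ring2.Hypotheses.MotivatedImpliesAlgebraicAV`, «published modulo X», X = `B` for the total spaces of compact abelian
pencils = the sub-cell's nodes `(5∀)/(5)`), gen 42. `HC_CM` (`Theses.RankFourFaces.CMAbelianHodge`) does not occur in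
this file; no case of the Hodge conjecture and no case of `B(X)` is proved: `B` is a displayed HYPOTHESIS throughout.

WHAT IS DISCHARGED. Sub-cell AbelianAll's SUPPLY NODE **(Q)** (ab-andre-1 part XI,
`Ring2AbelianAllLefschetzPencilsQuasiInverse`, `@[conjecture] def AlgebraicQuasiInverseOfLefschetzStandard`; «TRUE IN PRINT
as a theorem (assembled, per X) … The tree has no trace form on correspondences and no Hodge index theorem for them, so
this is a SUPPLY NODE: a HYPOTHESIS wherever used»): for `X` smooth projective of dimension `n` with `B⋆(X, η)` for all
`η`, degrees `a, b ≤ 2n`, and `u : Hᵃ(X(ℂ); ℂ) → Hᵇ(X(ℂ); ℂ)` induced by an algebraic class on `X × X`, there is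
`v : Hᵇ → Hᵃ` induced by an algebraic class on `X × X` with `u v u = u`. It was the one print-true hypothesis on the
edges `(5) ⟹ (β′)`, `(5)_d ⟹ (β′)_d`, the Tankeev rung `d = 2` of the β-ladder, the Leray idempotents
(`Ring2AbelianAllAndreLerayIdempotentRational`) and the row `HC_CM ⟹[h₂₁; Q_H; (5)] HC_AV` (part XIII); its Hodge twin
(Q_H) follows (`AlgebraicQuasiInverseOfLefschetzStandardHodge.of_algebraicQuasiInverse`, part XII). Theorem
`algebraicQuasiInverseOfLefschetzStandard_holds` below.

THE PROOF (not André's trace-form positivity; Jannsen's semisimplicity, already in the kernel, plus a Morita corner).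
(1) In a semisimple ring every element has a quasi-inverse (von Neumann): the left ideal `R u` has a complement,
`1 = e + f`, `u = u e`, `e = v u` (§1, pure algebra). (2) Gen 37 (`…AlgebraicCorrespondencesSemisimple`, Jannsen 1992 /
Kleiman 3.11 on the real carriers): under `B⋆(Z, θ)` the `ℂ`-algebra `R_k(Z)` of operators on `Hᵏ(Z(ℂ); ℂ)` induced by
`A^{dim Z}(Z ⊗ Z)_ℂ` is SEMISIMPLE — but this is ONE degree, and `u` changes the degree. (3) THE CORNER: embed both
`Hᵃ(X)` and `Hᵇ(X)` into ONE degree `k` of an auxiliary `Z` by ALGEBRAIC correspondences with ALGEBRAIC retractions,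
`ι : Hᵇ(X) → Hᵏ(Z)`, `p' ι = 1`, `ι' : Hᵃ(X) → Hᵏ(Z)`, `p ι' = 1` (§2, `exists_algebraic_quasiInverse_of_retractions`):
then `U := ι u p ∈ R_k(Z)`, a quasi-inverse `V ∈ R_k(Z)` of `U` is algebraic, and `v := p V ι` is an algebraic
quasi-inverse of `u = p' U ι'`. (4) THE AUXILIARY VARIETY (§3): `Z := X × W` for a complex ABELIAN VARIETY `W` of
dimension `m = |b − a| / 2` (the parity `a ≡ b (2)` is forced by the codimension equation of `u`), `k := max(a, b)`;
the same-degree retraction is `(pr_X^*, i^*)` and the degree-raising one is `(i_*, pr_{X*})` for the slice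
`i = (𝟙, 0_W) : X → X × W` (`i ≫ pr_X = 𝟙`; graphs and transposed graphs are algebraic, `isAlgebraicCorrespondence_map`,
`isAlgebraicCorrespondence_complexGysin`; functoriality `complexGysin_comp/_id`, `complexBetti.map_comp/_id`); and
`B⋆(X × W, θ)` for all `θ` from `B⋆(X, ·)` and LIEBERMAN'S THEOREM `B(W)` (the tree's
`standardConjectureBStar_abelianVariety`, `standardConjectureBStar_tensor_of_forall` — Kleiman Cor. 2.5). For `a = b`
any `W` (an elliptic curve) with the same-degree retraction twice.

So (Q) costs exactly: `B ⟹ SS` per degree (Jannsen) + `B` stable under products (Kleiman 2.5) + `B(A)` (Lieberman) +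
graphs of morphisms are algebraic — all theorems of the tree. No definition, no named fact, no sorry; `B` never asserted.
References: Andre1996Motifs (Prop. 3.3 pp. 21–22, Appendix Remarque 1 p. 47 — the printed route, NOT used), Jannsen1992
(Thm. 1, Lemma 1), Kleiman1968AlgebraicCycles (§2 Cor. 2.5, §3 Thm. 3.11, App. 2A11), Lieberman1968, Fulton1998
(§16.1 Prop. 16.1.1: correspondences compose), VoisinHodgeII2003 (§9.2.4 Prop. 9.20–9.21), GreenMurreVoisin1994
(Murre §7.7–7.8).
-/

noncomputable section

-- every declaration of this problem lives in `Summit.HodgeConjecture.HodgeConjecture.…` (summit = sub-problem)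
set_option linter.dupNamespace false

open CategoryTheory AlgebraicGeometry MonoidalCategory CartesianMonoidalCategory
open Literature.AlgebraicGeometry Literature.AlgebraicGeometry.Motives
  Literature.AlgebraicGeometry.HodgeTheory
open Summit.HodgeConjecture.HodgeConjecture.Ring2.AbelianAll

namespace Summit.HodgeConjecture.HodgeConjecture.Theorems

/-! ## §1 Von Neumann regularity of semisimple rings -/

/-- **In a semisimple ring every element has a quasi-inverse**: `∃ v, u v u = u`. The left ideal `R u` has a
complement `J` (semisimplicity of `R` as a left module over itself); writing `1 = e + f` with `e ∈ R u`, `f ∈ J`,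
one has `u f = u − u e ∈ R u ∩ J = 0`, so `u = u e` with `e = v u`. (Wedderburn; the «von Neumann regularity» used
by ab-andre-1 part XI (iv).) [folklore] -/
theorem exists_mul_mul_self_eq_of_isSemisimpleRing {R : Type*} [Ring R] [IsSemisimpleRing R] (u : R) :
    ∃ v : R, u * v * u = u := by
  obtain ⟨J, hJ⟩ := exists_isCompl (Ideal.span ({u} : Set R))
  have h1 : (1 : R) ∈ Ideal.span ({u} : Set R) ⊔ J := by
    rw [hJ.sup_eq_top]
    exact Submodule.mem_top
  obtain ⟨e, he, f, hf, hef⟩ := Submodule.mem_sup.mp h1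
  obtain ⟨v, rfl⟩ := Ideal.mem_span_singleton'.mp he
  refine ⟨v, ?_⟩
  -- `u f ∈ R u ∩ J = 0`
  have huf : u * f ∈ Ideal.span ({u} : Set R) ⊓ J := by
    refine ⟨?_, J.smul_mem u hf⟩
    have : u * f = u - (u * v) * u := by
      rw [eq_sub_iff_add_eq, mul_assoc, ← mul_add, add_comm, hef, mul_one]
    rw [this]
    exact Submodule.sub_mem _ (Ideal.mem_span_singleton'.mpr ⟨1, one_mul u⟩)
      (Ideal.mem_span_singleton'.mpr ⟨u * v, rfl⟩)
  rw [hJ.inf_eq_bot, Ideal.mem_bot] at huf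
  calc u * v * u = u * v * u + u * f := by rw [huf, add_zero]
    _ = u * (v * u + f) := by rw [mul_add, mul_assoc]
    _ = u := by rw [hef, mul_one]

/-! ## §2 The corner argument: one semisimple operator algebra in ONE degree of an auxiliary variety suffices -/

section Corner

variable {n N : ℕ} {X Z : SchemeOver ℂ}

/-- **Algebraic quasi-inverses from ONE semisimple correspondence algebra (the Morita corner).** Let `X`, `Z` be smooth
projective of dimensions `n`, `N`, `B⋆(Z, θ)` for a polarisation class `θ` of `Z` (so that the operator algebra of
`A^N(Z ⊗ Z)_ℂ` on `Hᵏ(Z(ℂ); ℂ)` is semisimple, gen 37), and suppose `Hᵇ(X)` EMBEDS into `Hᵏ(Z)` and `Hᵃ(X)` is a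
QUOTIENT of `Hᵏ(Z)` through algebraic correspondences: `ι : Hᵇ(X) → Hᵏ(Z)` algebraic injective, `p : Hᵏ(Z) → Hᵃ(X)`
algebraic surjective. Then every algebraic `u : Hᵃ(X) → Hᵇ(X)` has an algebraic quasi-inverse: with ANY linear
retractions `p' ι = 1`, `p ι' = 1`, `U := ι u p` lies in the semisimple algebra, has a quasi-inverse `V` there (§1),
`V` is algebraic, and `v := p V ι` satisfies `u v u = p'(U V U)ι' = p' U ι' = u`. [cite: Jannsen1992, Thm. 1]
[cite: Fulton1998, §16.1 Prop. 16.1.1] [cite: Kleiman1968AlgebraicCycles, §3 Thm. 3.11] -/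
theorem exists_algebraic_quasiInverse_of_injective_of_surjective (hX : IsSmoothProjective n X)
    (hZ : IsSmoothProjective N Z) {θ : complexBetti Z 2} (hθ : IsPolarizationClass N Z θ)
    (hBZ : StandardConjectureBStar N Z θ) {a b k : ℕ} (hb : b ≤ 2 * n) (hk : k ≤ 2 * N)
    {ι : complexBetti X b →ₗ[ℂ] complexBetti Z k} {p : complexBetti Z k →ₗ[ℂ] complexBetti X a}
    (hι : IsAlgebraicCorrespondence N n Z X ι) (hp : IsAlgebraicCorrespondence n N X Z p)
    (hιi : Function.Injective ι) (hps : Function.Surjective p)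
    {u : complexBetti X a →ₗ[ℂ] complexBetti X b} (hu : IsAlgebraicCorrespondence n n X X u) :
    ∃ v : complexBetti X b →ₗ[ℂ] complexBetti X a,
      IsAlgebraicCorrespondence n n X X v ∧ ∀ x : complexBetti X a, u (v (u x)) = u x := by
  -- linear retractions (no algebraicity needed for these)
  obtain ⟨p', hpι⟩ := ι.exists_leftInverse_of_injective (LinearMap.ker_eq_bot.mpr hιi)
  obtain ⟨ι', hpι'⟩ := p.exists_rightInverse_of_surjective (LinearMap.range_eq_top.mpr hps)
  -- the compressed operator `U = ι u p` on `Hᵏ(Z)` is an algebraic self-correspondence of `Z`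
  set U : complexBetti Z k →ₗ[ℂ] complexBetti Z k := ι ∘ₗ u ∘ₗ p with hUdef
  have hU : IsAlgebraicCorrespondence N N Z Z U :=
    IsAlgebraicCorrespondence.comp hZ hX hZ (IsAlgebraicCorrespondence.comp hX hX hZ hp hu (by omega)) hι
      (by omega)
  -- normalise it to the complex orientations: `U = [Γ]_*`, `Γ ∈ A^N(Z ⊗ Z)_ℂ`
  obtain ⟨e, hke, Γ, hΓ, hUΓ⟩ := IsAlgebraicCorrespondence.exists_eq_corrAction hZ hZ hU
  obtain rfl : N = e := by omega
  -- the semisimple operator algebra in degree `k`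
  set M : Submodule ℂ (Module.End ℂ (complexBetti Z k)) := (algebraicClasses (Z ⊗ Z) N).map
    (corrAction complexOrientationFamily hZ hZ (rfl : k + 2 * N = k + 2 * N)) with hMdef
  set R : Subalgebra ℂ (Module.End ℂ (complexBetti Z k)) :=
    Algebra.adjoin ℂ (M : Set (Module.End ℂ (complexBetti Z k))) with hRdef
  haveI : IsSemisimpleRing R := isSemisimpleRing_adjoin_algebraicOperators_of_standardConjectureBStar hZ hθ hBZ k
  have hRM : ∀ x : Module.End ℂ (complexBetti Z k), x ∈ R ↔ x ∈ M := fun x ↦ by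
    rw [← SetLike.mem_coe, hRdef, hMdef, adjoin_algebraicOperators_eq complexOrientationFamily hZ k, SetLike.mem_coe]
  have hUM : U ∈ M := ⟨Γ, hΓ, hUΓ.symm⟩
  -- a quasi-inverse inside `R`
  obtain ⟨V, hV⟩ := exists_mul_mul_self_eq_of_isSemisimpleRing (R := R) ⟨U, (hRM U).mpr hUM⟩
  have hVM : (V : Module.End ℂ (complexBetti Z k)) ∈ M := (hRM _).mp V.2
  obtain ⟨Γ', hΓ', hVΓ'⟩ := hVM
  have hValg : IsAlgebraicCorrespondence N N Z Z (V : Module.End ℂ (complexBetti Z k)) := by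
    rw [← hVΓ']
    exact isAlgebraicCorrespondence_corrAction_complex hZ hZ rfl hk hΓ'
  have hUVU : ∀ z : complexBetti Z k, U ((V : Module.End ℂ (complexBetti Z k)) (U z)) = U z := fun z ↦ by
    have h := congrArg (fun T : R ↦ (T : Module.End ℂ (complexBetti Z k)) z) hV
    simpa only [Subalgebra.coe_mul, Module.End.mul_apply] using h
  -- the quasi-inverse of `u`
  refine ⟨p ∘ₗ (V : Module.End ℂ (complexBetti Z k)) ∘ₗ ι, ?_, fun x ↦ ?_⟩
  · exact IsAlgebraicCorrespondence.comp hX hZ hX (IsAlgebraicCorrespondence.comp hZ hZ hX hι hValg (by omega)) hp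
      (by omega)
  · have hpι'x : p (ι' x) = x := by
      simpa only [LinearMap.comp_apply, LinearMap.id_apply] using LinearMap.congr_fun hpι' x
    have hp'ι : ∀ y : complexBetti X b, p' (ι y) = y := fun y ↦ by
      simpa only [LinearMap.comp_apply, LinearMap.id_apply] using LinearMap.congr_fun hpι y
    have h := hUVU (ι' x)
    simp only [hUdef, LinearMap.comp_apply, hpι'x] at h
    have h' := congrArg p' h
    rwa [hp'ι, hp'ι] at h'

end Corner

/-! ## §3 The auxiliary variety `X × W`, `W` abelian: algebraic embeddings / quotients between degrees of different parity class -/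

section Auxiliary

variable {n m : ℕ} {X W : SchemeOver ℂ}

/-- `i^* ∘ pr_X^* = 1` on `Hᶜ(X(ℂ); ℂ)` for the slice `i = (𝟙, w₀) : X → X × W` at a point `w₀ ∈ W(ℂ)` (`i ≫ pr_X = 𝟙`).
[cite: FultonYoungTableaux1997, Appendix B §B.1 (1)] [cite: Fulton1998, §10.1 (the slice X × {t})] -/
theorem map_sliceAt_comp_map_fst (w₀ : ComplexPoints W) (c : ℕ) :
    (complexBetti.map (sliceAt X w₀) c).hom ∘ₗ (complexBetti.map (fst X W) c).hom = LinearMap.id := by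
  rw [← ModuleCat.hom_comp, ← complexBetti.map_comp, sliceAt_fst, complexBetti.map_id, ModuleCat.hom_id]

/-- `pr_{X*} ∘ i_* = 1` on `Hᶜ(X(ℂ); ℂ)` for the slice `i = (𝟙, w₀) : X → X × W` (`(i ≫ pr_X)_* = 𝟙_* = 1`; complex
orientations). [cite: FultonYoungTableaux1997, Appendix B §B.1 (2) and (5)] -/
theorem complexGysin_fst_comp_complexGysin_sliceAt (hX : IsSmoothProjective n X) (hW : IsSmoothProjective m W)
    (w₀ : ComplexPoints W) {c d : ℕ} (h1 : c + 2 * (n + m) = d + 2 * n) (h2 : d + 2 * n = c + 2 * (n + m)) :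
    complexGysin complexOrientationFamily (hX.tensor_holds hW) hX (fst X W) h2 ∘ₗ
      complexGysin complexOrientationFamily hX (hX.tensor_holds hW) (sliceAt X w₀) h1 = LinearMap.id := by
  rw [← complexGysin_comp hasPoincareDuality_complexOrientationFamily hX (hX.tensor_holds hW) hX (sliceAt X w₀)
    (fst X W) h1 h2, sliceAt_fst]
  exact complexGysin_id hasPoincareDuality_complexOrientationFamily hX c

/-- **`B⋆(X × W, θ)` for every `θ`, `W` a complex abelian variety, granted `B⋆(X, η)` for all `η`** — Lieberman's
theorem `B(W)` (the tree's `standardConjectureBStar_abelianVariety`) and stability of `B⋆` under products (Kleiman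
Cor. 2.5, ab-andre's `standardConjectureBStar_tensor_of_forall`). [cite: Lieberman1968, main theorem]
[cite: Kleiman1968AlgebraicCycles, §2 Cor. 2.5] -/
theorem standardConjectureBStar_tensor_abelianVariety_of_forall (hX : IsSmoothProjective n X)
    (hB : ∀ η : complexBetti X 2, StandardConjectureBStar n X η) (W : AbelianVariety ℂ)
    (θ : complexBetti (X ⊗ W.X) 2) : StandardConjectureBStar (n + W.dim) (X ⊗ W.X) θ :=
  standardConjectureBStar_tensor_of_forall hX (AbelianVariety.isSmoothProjective_holds (A := W)) hB
    (fun η ↦ standardConjectureBStar_abelianVariety W η) θ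

end Auxiliary

/-! ## §4 (Q) discharged -/

/-- **(Q) IS A THEOREM: under `B(X)` every algebraic correspondence `u : Hᵃ(X(ℂ); ℂ) → Hᵇ(X(ℂ); ℂ)` (`a, b ≤ 2 dim X`)
has an algebraic quasi-inverse `v : Hᵇ → Hᵃ`, `u v u = u`** — the sub-cell AbelianAll supply node
`AlgebraicQuasiInverseOfLefschetzStandard` (ab-andre-1 part XI) discharged. Write `a + 2e = b + 2n` (the codimension
`e` of a class inducing `u`) and let `W` be a complex abelian variety of dimension `|e − n|` (any elliptic curve if
`e = n`), `Z := X × W`, `i = (𝟙, 0) : X → Z`: if `e ≤ n` (`a ≥ b`) take `k := a`, `ι := i_* : Hᵇ(X) ↪ Hᵃ(Z)` resp.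
`ι := pr_X^*` when `e = n`, and `p := i^* : Hᵃ(Z) ↠ Hᵃ(X)`; if `e > n` (`a < b`) take `k := b`, `ι := pr_X^* : Hᵇ(X) ↪
Hᵇ(Z)`, `p := pr_{X*} : Hᵇ(Z) ↠ Hᵃ(X)` — injective resp. surjective by `i ≫ pr_X = 𝟙` (§3); `B⋆(Z)` by Lieberman and
Kleiman 2.5 (§3); conclude by the corner §2 over the semisimple algebra of gen 37 (Jannsen). `B(X)` is the displayed
HYPOTHESIS of the node; nothing is asserted about it. [cite: Jannsen1992, Thm. 1]
[cite: Kleiman1968AlgebraicCycles, §2 Cor. 2.5 and §3 Thm. 3.11] [cite: Lieberman1968, main theorem]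
[cite: Andre1996Motifs, Prop. 3.3 (pp. 21–22) and Appendix Remarque 1 (p. 47)] -/
theorem algebraicQuasiInverseOfLefschetzStandard_holds : AlgebraicQuasiInverseOfLefschetzStandard := by
  intro n X hX hB a b ha hb u hu
  obtain ⟨e, hab, -, -, -⟩ := IsAlgebraicCorrespondence.exists_eq_corrAction hX hX hu
  have hPD := hasPoincareDuality_complexOrientationFamily
  rcases Nat.lt_trichotomy e n with hlt | heq | hgt
  · -- `e < n`: `a = b + 2m`, `m = n - e`; embed `Hᵇ(X)` by `i_*` and project `Hᵃ(Z)` by `i^*`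
    obtain ⟨W, hWd⟩ := exists_abelianVariety_dim_eq_succ ℂ (n - e - 1)
    have hm : e + W.dim = n := by omega
    have hW : IsSmoothProjective W.dim W.X := AbelianVariety.isSmoothProjective_holds (A := W)
    have hZ : IsSmoothProjective (n + W.dim) (X ⊗ W.X) := hX.tensor_holds hW
    obtain ⟨θ, hθ⟩ := exists_isPolarizationClass hZ
    set w₀ : ComplexPoints W.X := (1 : W.Points ℂ)
    have h1 : b + 2 * (n + W.dim) = a + 2 * n := by omega
    have h2 : a + 2 * n = b + 2 * (n + W.dim) := by omega
    refine exists_algebraic_quasiInverse_of_injective_of_surjective hX hZ hθ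
      (standardConjectureBStar_tensor_abelianVariety_of_forall hX hB W θ) hb (k := a) (by omega)
      (isAlgebraicCorrespondence_complexGysin complexOrientationFamily hPD hX hZ (sliceAt X w₀) h1
        (show a + (2 * (n + W.dim) - a) = 2 * (n + W.dim) by omega))
      (isAlgebraicCorrespondence_map hX hZ (sliceAt X w₀) ha) ?_ ?_ hu
    · exact Function.LeftInverse.injective (g := complexGysin complexOrientationFamily hZ hX (fst X W.X) h2)
        fun x ↦ by
          simpa only [LinearMap.comp_apply, LinearMap.id_apply] using
            LinearMap.congr_fun (complexGysin_fst_comp_complexGysin_sliceAt hX hW w₀ h1 h2) x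
    · exact Function.RightInverse.surjective (g := (complexBetti.map (fst X W.X) a).hom) fun x ↦ by
        simpa only [LinearMap.comp_apply, LinearMap.id_apply] using
          LinearMap.congr_fun (map_sliceAt_comp_map_fst (X := X) w₀ a) x
  · -- `e = n`: `a = b`; any elliptic curve `W`, embed and project in the same degree
    subst heq
    obtain rfl : a = b := by omega
    obtain ⟨W, -⟩ := exists_abelianVariety_dim_eq_succ ℂ 0
    have hW : IsSmoothProjective W.dim W.X := AbelianVariety.isSmoothProjective_holds (A := W)
    have hZ : IsSmoothProjective (e + W.dim) (X ⊗ W.X) := hX.tensor_holds hW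
    obtain ⟨θ, hθ⟩ := exists_isPolarizationClass hZ
    set w₀ : ComplexPoints W.X := (1 : W.Points ℂ)
    refine exists_algebraic_quasiInverse_of_injective_of_surjective hX hZ hθ
      (standardConjectureBStar_tensor_abelianVariety_of_forall hX hB W θ) hb (k := a) (by omega)
      (isAlgebraicCorrespondence_map hZ hX (fst X W.X) (by omega))
      (isAlgebraicCorrespondence_map hX hZ (sliceAt X w₀) ha) ?_ ?_ hu
    · exact Function.LeftInverse.injective (g := (complexBetti.map (sliceAt X w₀) a).hom) fun x ↦ by
        simpa only [LinearMap.comp_apply, LinearMap.id_apply] using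
          LinearMap.congr_fun (map_sliceAt_comp_map_fst (X := X) w₀ a) x
    · exact Function.RightInverse.surjective (g := (complexBetti.map (fst X W.X) a).hom) fun x ↦ by
        simpa only [LinearMap.comp_apply, LinearMap.id_apply] using
          LinearMap.congr_fun (map_sliceAt_comp_map_fst (X := X) w₀ a) x
  · -- `n < e`: `b = a + 2m`, `m = e - n`; embed `Hᵇ(X)` by `pr_X^*` and project `Hᵇ(Z)` by `pr_{X*}`
    obtain ⟨W, hWd⟩ := exists_abelianVariety_dim_eq_succ ℂ (e - n - 1)
    have hm : n + W.dim = e := by omega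
    have hW : IsSmoothProjective W.dim W.X := AbelianVariety.isSmoothProjective_holds (A := W)
    have hZ : IsSmoothProjective (n + W.dim) (X ⊗ W.X) := hX.tensor_holds hW
    obtain ⟨θ, hθ⟩ := exists_isPolarizationClass hZ
    set w₀ : ComplexPoints W.X := (1 : W.Points ℂ)
    have h1 : a + 2 * (n + W.dim) = b + 2 * n := by omega
    have h2 : b + 2 * n = a + 2 * (n + W.dim) := by omega
    refine exists_algebraic_quasiInverse_of_injective_of_surjective hX hZ hθ
      (standardConjectureBStar_tensor_abelianVariety_of_forall hX hB W θ) hb (k := b) (by omega)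
      (isAlgebraicCorrespondence_map hZ hX (fst X W.X) (by omega))
      (isAlgebraicCorrespondence_complexGysin complexOrientationFamily hPD hZ hX (fst X W.X) h2
        (show a + (2 * n - a) = 2 * n by omega)) ?_ ?_ hu
    · exact Function.LeftInverse.injective (g := (complexBetti.map (sliceAt X w₀) b).hom) fun x ↦ by
        simpa only [LinearMap.comp_apply, LinearMap.id_apply] using
          LinearMap.congr_fun (map_sliceAt_comp_map_fst (X := X) w₀ b) x
    · exact Function.RightInverse.surjective
        (g := complexGysin complexOrientationFamily hX hZ (sliceAt X w₀) h1) fun x ↦ by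
          simpa only [LinearMap.comp_apply, LinearMap.id_apply] using
            LinearMap.congr_fun (complexGysin_fst_comp_complexGysin_sliceAt hX hW w₀ h1 h2) x

/-- **The Hodge-cut-down twin (Q_H) `AlgebraicQuasiInverseOfLefschetzStandardHodge` (ab-andre-1 part XII) is a
theorem as well** (it is weaker than (Q): part XII's `of_algebraicQuasiInverse`). This is the node displayed as `hQ`
by the RE-BASED rows of part XIII (`Ring2AbelianAllLefschetzPencilsQuasiInverseHodgeRebase`), in particular by the row
`HC_CM ⟹[h₂₁; Q_H; (5)] HC_AV`. [cite: Andre1996Motifs, Prop. 3.3 (pp. 21–22) and Appendix Remarque 1 (p. 47)]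
[cite: Jannsen1992, Thm. 1] -/
theorem algebraicQuasiInverseOfLefschetzStandardHodge_holds : AlgebraicQuasiInverseOfLefschetzStandardHodge :=
  AlgebraicQuasiInverseOfLefschetzStandardHodge.of_algebraicQuasiInverse
    algebraicQuasiInverseOfLefschetzStandard_holds

end Summit.HodgeConjecture.HodgeConjecture.Theorems

end
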